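import Literature.Analysis.FluidPDE.CompressibleEulerImplosionBulkCertificate
import Literature.Analysis.FluidPDE.CompressibleEulerImplosionCentreSeriesCalculus
import HarnessLib

/-!
# Buckmaster–Cao-Labora–Gómez-Serrano at `γ = 5/3`: the eight certified bulk envelopes of the series profile

Companion of `…BulkCertificate` (the seventeen kernel-certified sign conditions `Pt.Pos` at every point of the bulk
`ζ = c eˣ ∈ [c/100, c/2]`, `c ∈ [17/50, 23/50]`) and `…CentreSeriesCalculus` (the series profile `Wser r c`, `Sser r c`
and its `x`-derivatives as the nine reals `pt r c ζ`). Main theorem `bulk_envelopes_window2`: for every `r` in the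
shooting window `[13890041/12500000, 697/625]`, every sonic scale `c ∈ [17/50, 23/50]` and every
`x ∈ [log(1/100), −7/10]`, the eight inequalities of clause (g) `CavityTubeBulk` of the cavity tube of the crux
`DenseExcursion` (line `sonic-cavity-renewal`) hold for `(Wser r c, Sser r c)` — written out with the definitions of
the couplings `G, H`, the drift `R`, the growth and the slowness unfolded (`|G| ≤ e^{−x}/2`, `|G′| ≤ 0.51e^{−x}`,
`|H| ≤ 0.51e^{−x} + 0.61`, `|H′| ≤ 0.51e^{−x}`, `|b₋₊||b₊₋|/(2S) ≤ 0.53e^{−x}`, `|R′| ≤ 1/5`,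
`b₊₊/c₊ + b₋₋/|c₋| ≤ eˣ(3 + 4e^{2x} + 10e^{4x})`, `1/c₊ + 1/|c₋| ≤ eˣ(17/5 + 4e^{2x} + 8e^{4x})`).
Ingredients: the derivative formulas `deriv_G_eq`, `deriv_H_eq`, `deriv_R_eq` of the three composite quantities and the
pure algebra `Pt.bulk_of_pos` turning the sign conditions into the envelopes. No facts, no axioms.

[cite: BuckmasterCaolaboraGomezserrano2025, Prop. 2.5, App. B]
-/

noncomputable section

open Filter Topology

namespace Literature.Analysis.FluidPDE

namespace BuckmasterCaolaboraGomezserrano2025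

namespace OriginSeries

namespace CentreW2

set_option linter.style.longLine false
set_option linter.style.setOption false
set_option maxHeartbeats 1600000

/-! ### Derivative formulas of the three composite quantities -/

/-- `G′` in terms of `(W, W′, W″, S, S′, S″)`. [folklore] -/
def Gd (W0 W1 W2 S0 S1 S2 : ℝ) : ℝ :=
  (((W2 / 3 - S2 - 2 * S1) * (W0 - 1 + S0) + (W1 / 3 - S1 - 2 * S0) * (W1 + S1)) * (2 * S0)
    - (W1 / 3 - S1 - 2 * S0) * (W0 - 1 + S0) * (2 * S1)) / (2 * S0) ^ 2

/-- `H′` in terms of `(W, W′, W″, S, S′, S″)`. [folklore] -/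
def Hd (W0 W1 W2 S0 S1 S2 : ℝ) : ℝ :=
  (((W2 / 3 + S2 + 2 * S1) * (W0 - 1 - S0) + (W1 / 3 + S1 + 2 * S0) * (W1 - S1)) * (2 * S0)
    - (W1 / 3 + S1 + 2 * S0) * (W0 - 1 - S0) * (2 * S1)) / (2 * S0) ^ 2

/-- `R′` in terms of `(W, W′, W″, S, S′, S″, r)`. [folklore] -/
def Rd (W0 W1 W2 S0 S1 S2 : ℝ) : ℝ :=
  -(2 / 3 * W2 + 2 * W1) + ((W1 * (2 * S1 + 4 * S0) + (W0 - 1) * (2 * S2 + 4 * S1)) * S0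
    - (W0 - 1) * (2 * S1 + 4 * S0) * S1) / S0 ^ 2

variable {W S : ℝ → ℝ} {x W1 W2 S1 S2 : ℝ}

/-- The derivative of the coupling `G = (W′/3 − S′ − 2S)(W − 1 + S)/(2S)`. [folklore] -/
theorem deriv_G_eq (hW : HasDerivAt W W1 x) (hW2 : HasDerivAt (deriv W) W2 x) (hS : HasDerivAt S S1 x)
    (hS2 : HasDerivAt (deriv S) S2 x) (hS0 : S x ≠ 0) :
    deriv (fun y => (deriv W y / 3 - deriv S y - 2 * S y) * (W y - 1 + S y) / (2 * S y)) x = Gd (W x) W1 W2 (S x) S1 S2 := by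
  have h := ((((hW2.div_const 3).fun_sub hS2).fun_sub (hS.const_mul 2)).fun_mul ((hW.sub_const 1).fun_add hS)).fun_div
    (hS.const_mul 2) (mul_ne_zero two_ne_zero hS0)
  rw [h.deriv, hW.deriv, hS.deriv]
  unfold Gd
  ring

/-- The derivative of the coupling `H = (W′/3 + S′ + 2S)(W − 1 − S)/(2S)`. [folklore] -/
theorem deriv_H_eq (hW : HasDerivAt W W1 x) (hW2 : HasDerivAt (deriv W) W2 x) (hS : HasDerivAt S S1 x)
    (hS2 : HasDerivAt (deriv S) S2 x) (hS0 : S x ≠ 0) :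
    deriv (fun y => (deriv W y / 3 + deriv S y + 2 * S y) * (W y - 1 - S y) / (2 * S y)) x = Hd (W x) W1 W2 (S x) S1 S2 := by
  have h := ((((hW2.div_const 3).fun_add hS2).fun_add (hS.const_mul 2)).fun_mul ((hW.sub_const 1).fun_sub hS)).fun_div
    (hS.const_mul 2) (mul_ne_zero two_ne_zero hS0)
  rw [h.deriv, hW.deriv, hS.deriv]
  unfold Hd
  ring

/-- The derivative of the drift part `R = −(⅔W′ + 2W − r) + (W − 1)(2S′ + 4S)/S`. [folklore] -/
theorem deriv_R_eq (r : ℝ) (hW : HasDerivAt W W1 x) (hW2 : HasDerivAt (deriv W) W2 x) (hS : HasDerivAt S S1 x)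
    (hS2 : HasDerivAt (deriv S) S2 x) (hS0 : S x ≠ 0) :
    deriv (fun y => -(2 / 3 * deriv W y + 2 * W y - r) + (W y - 1) * (2 * deriv S y + 4 * S y) / S y) x = Rd (W x) W1 W2 (S x) S1 S2 := by
  have h := (((hW2.const_mul (2 / 3)).fun_add (hW.const_mul 2)).sub_const r).fun_neg.fun_add
    (((hW.sub_const 1).fun_mul ((hS2.const_mul 2).fun_add (hS.const_mul 4))).fun_div hS hS0)
  rw [h.deriv, hS.deriv]
  unfold Rd
  ring

/-! ### Algebra: from the sign conditions to the eight envelopes -/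

namespace Pt

/-- **The seventeen sign conditions imply the eight envelopes** (with `S = ζS/ζ`, `S′ = ζS′/ζ`, `S″ = ζS″/ζ`,
`e^{−x} = c/ζ`, `eˣ = ζ/c`). [folklore] -/
theorem bulk_of_pos (p : Pt) {e : ℝ} (hP : p.Pos e) (hz : 0 < p.z) (hc : 0 < p.c) (he0 : 0 < e) (he : e ≤ 1 / p.c) :
    |(p.W1 / 3 - p.s1 / p.z - 2 * (p.s0 / p.z)) * (p.W0 - 1 + p.s0 / p.z) / (2 * (p.s0 / p.z))| ≤ 1 / 2 * (p.c / p.z) ∧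
    |Gd p.W0 p.W1 p.W2 (p.s0 / p.z) (p.s1 / p.z) (p.s2 / p.z)| ≤ 51 / 100 * (p.c / p.z) ∧
    |(p.W1 / 3 + p.s1 / p.z + 2 * (p.s0 / p.z)) * (p.W0 - 1 - p.s0 / p.z) / (2 * (p.s0 / p.z))| ≤ 51 / 100 * (p.c / p.z) + 61 / 100 ∧
    |Hd p.W0 p.W1 p.W2 (p.s0 / p.z) (p.s1 / p.z) (p.s2 / p.z)| ≤ 51 / 100 * (p.c / p.z) ∧
    |p.W1 / 3 - p.s1 / p.z - 2 * (p.s0 / p.z)| * |p.W1 / 3 + p.s1 / p.z + 2 * (p.s0 / p.z)| / (2 * (p.s0 / p.z)) ≤ 53 / 100 * (p.c / p.z) ∧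
    |Rd p.W0 p.W1 p.W2 (p.s0 / p.z) (p.s1 / p.z) (p.s2 / p.z)| ≤ 1 / 5 ∧
    (2 / 3 * p.W1 + 2 * p.W0 - p.r + 2 * (p.s1 / p.z) + 4 * (p.s0 / p.z)) / (p.W0 - 1 + p.s0 / p.z)
      + (2 / 3 * p.W1 + 2 * p.W0 - p.r - 2 * (p.s1 / p.z) - 4 * (p.s0 / p.z)) / |p.W0 - 1 - p.s0 / p.z|
        ≤ p.z / p.c * (3 + 4 * (p.z / p.c) ^ 2 + 10 * (p.z / p.c) ^ 4) ∧
    1 / (p.W0 - 1 + p.s0 / p.z) + 1 / |p.W0 - 1 - p.s0 / p.z| ≤ p.z / p.c * (17 / 5 + 4 * (p.z / p.c) ^ 2 + 8 * (p.z / p.c) ^ 4) := by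
  obtain ⟨q1, q2, q3, q4, q5, q6, q7, q8, q9, q10, q11, q12, q13, q14, q15, q16, q17⟩ := hP
  have hz' : p.z ≠ 0 := hz.ne'
  have hs0' : p.s0 ≠ 0 := q1.ne'
  have hB' : p.B ≠ 0 := q2.ne'
  have hBm' : p.Bm ≠ 0 := by intro h0; rw [h0, neg_zero] at q3; exact lt_irrefl _ q3
  have hBBm : 0 < p.B * -p.Bm := mul_pos q2 q3
  -- the scaled quantities
  have dA : p.W1 / 3 - p.s1 / p.z - 2 * (p.s0 / p.z) = p.A / p.z := by unfold Pt.A; field_simp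
  have dAp : p.W1 / 3 + p.s1 / p.z + 2 * (p.s0 / p.z) = p.Ap / p.z := by unfold Pt.Ap; field_simp
  have dB : p.W0 - 1 + p.s0 / p.z = p.B / p.z := by unfold Pt.B; field_simp
  have dBm : p.W0 - 1 - p.s0 / p.z = p.Bm / p.z := by unfold Pt.Bm; field_simp
  have dS : 2 * (p.s0 / p.z) = 2 * p.s0 / p.z := by ring
  have h2s : 0 < 2 * p.s0 * p.z := by have := q1; positivity
  have habsBm : |p.Bm / p.z| = -p.Bm / p.z := by
    rw [abs_of_neg (div_neg_of_neg_of_pos (by linarith) hz)]; ring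
  -- monotonicity of the two right-hand sides in `e`
  have he1 : 0 < 1 / p.c := by positivity
  have hee : e * e ≤ 1 / p.c * (1 / p.c) := mul_le_mul he he he0.le he1.le
  have hzz : 0 ≤ p.z * p.z := by positivity
  have hm7 : p.rhs7 e ≤ p.rhs7 (1 / p.c) := by
    unfold Pt.rhs7
    have h4 : e * e * (p.z * p.z) ≤ 1 / p.c * (1 / p.c) * (p.z * p.z) := mul_le_mul_of_nonneg_right hee hzz
    have h0 : 0 ≤ e * e * (p.z * p.z) := by positivity
    gcongr
  have hm8 : p.rhs8 e ≤ p.rhs8 (1 / p.c) := by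
    unfold Pt.rhs8
    have h4 : e * e * (p.z * p.z) ≤ 1 / p.c * (1 / p.c) * (p.z * p.z) := mul_le_mul_of_nonneg_right hee hzz
    have h0 : 0 ≤ e * e * (p.z * p.z) := by positivity
    gcongr
  have r7 : p.z * p.rhs7 (1 / p.c) = p.z / p.c * (3 + 4 * (p.z / p.c) ^ 2 + 10 * (p.z / p.c) ^ 4) := by
    unfold Pt.rhs7; field_simp
  have r8 : p.z * p.rhs8 (1 / p.c) = p.z / p.c * (17 / 5 + 4 * (p.z / p.c) ^ 2 + 8 * (p.z / p.c) ^ 4) := by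
    unfold Pt.rhs8; field_simp
  refine ⟨?_, ?_, ?_, ?_, ?_, ?_, ?_, ?_⟩
  · -- B1
    rw [dA, dB, dS, show p.A / p.z * (p.B / p.z) / (2 * p.s0 / p.z) = p.A * p.B / (2 * p.s0 * p.z) by field_simp,
      abs_div, abs_of_pos h2s, div_le_iff₀ h2s, show 1 / 2 * (p.c / p.z) * (2 * p.s0 * p.z) = p.c * p.s0 by field_simp]
    exact abs_le.mpr ⟨by linarith, by linarith⟩
  · -- B2
    have h2 : 0 < 2 * (p.s0 * p.s0) * p.z := by positivity
    rw [show Gd p.W0 p.W1 p.W2 (p.s0 / p.z) (p.s1 / p.z) (p.s2 / p.z) = p.numG / (2 * (p.s0 * p.s0) * p.z) by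
      unfold Gd Pt.numG Pt.Ad Pt.Bd Pt.A Pt.B; field_simp,
      abs_div, abs_of_pos h2, div_le_iff₀ h2, show 51 / 100 * (p.c / p.z) * (2 * (p.s0 * p.s0) * p.z) = 51 * (p.c * (p.s0 * p.s0)) / 50 by field_simp; ring]
    exact abs_le.mpr ⟨by linarith, by linarith⟩
  · -- B3
    rw [dAp, dBm, dS, show p.Ap / p.z * (p.Bm / p.z) / (2 * p.s0 / p.z) = p.Ap * p.Bm / (2 * p.s0 * p.z) by field_simp,
      abs_div, abs_of_pos h2s, div_le_iff₀ h2s,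
      show (51 / 100 * (p.c / p.z) + 61 / 100) * (2 * p.s0 * p.z) = p.s0 * (51 * p.c / 50 + 61 * p.z / 50) by field_simp; ring]
    exact abs_le.mpr ⟨by linarith, by linarith⟩
  · -- B4
    have h2 : 0 < 2 * (p.s0 * p.s0) * p.z := by positivity
    rw [show Hd p.W0 p.W1 p.W2 (p.s0 / p.z) (p.s1 / p.z) (p.s2 / p.z) = p.numH / (2 * (p.s0 * p.s0) * p.z) by
      unfold Hd Pt.numH Pt.Apd Pt.Bmd Pt.Ap Pt.Bm; field_simp,
      abs_div, abs_of_pos h2, div_le_iff₀ h2, show 51 / 100 * (p.c / p.z) * (2 * (p.s0 * p.s0) * p.z) = 51 * (p.c * (p.s0 * p.s0)) / 50 by field_simp; ring]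
    exact abs_le.mpr ⟨by linarith, by linarith⟩
  · -- B5
    rw [dA, dAp, dS, abs_div, abs_div, abs_of_pos hz,
      show |p.A| / p.z * (|p.Ap| / p.z) / (2 * p.s0 / p.z) = |p.A| * |p.Ap| / (2 * p.s0 * p.z) by field_simp,
      ← abs_mul, div_le_iff₀ h2s, show 53 / 100 * (p.c / p.z) * (2 * p.s0 * p.z) = 53 * (p.c * p.s0) / 50 by field_simp; ring]
    exact abs_le.mpr ⟨by linarith, by linarith⟩
  · -- B6
    have h2 : 0 < p.s0 * p.s0 := by positivity
    rw [show Rd p.W0 p.W1 p.W2 (p.s0 / p.z) (p.s1 / p.z) (p.s2 / p.z) = p.numR / (p.s0 * p.s0) by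
      unfold Rd Pt.numR Pt.P24; field_simp; ring,
      abs_div, abs_of_pos h2, div_le_iff₀ h2, show 1 / 5 * (p.s0 * p.s0) = p.s0 * p.s0 / 5 by ring]
    exact abs_le.mpr ⟨by linarith, by linarith⟩
  · -- B7
    rw [dB, dBm, habsBm,
      show 2 / 3 * p.W1 + 2 * p.W0 - p.r + 2 * (p.s1 / p.z) + 4 * (p.s0 / p.z) = (p.z * p.K + p.P24) / p.z by unfold Pt.K Pt.P24; field_simp; ring,
      show 2 / 3 * p.W1 + 2 * p.W0 - p.r - 2 * (p.s1 / p.z) - 4 * (p.s0 / p.z) = (p.z * p.K - p.P24) / p.z by unfold Pt.K Pt.P24; field_simp; ring,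
      show (p.z * p.K + p.P24) / p.z / (p.B / p.z) + (p.z * p.K - p.P24) / p.z / (-p.Bm / p.z)
        = 2 * p.z * (p.K * p.s0 - p.P24 * (p.W0 - 1)) / (p.B * -p.Bm) by
          have : -p.Bm ≠ 0 := q3.ne'
          unfold Pt.B Pt.Bm at *; field_simp; ring,
      div_le_iff₀ hBBm, ← r7]
    have k : 2 * (p.K * p.s0 - p.P24 * (p.W0 - 1)) < p.rhs7 e * (p.B * -p.Bm) := by linarith
    have k2 : p.rhs7 e * (p.B * -p.Bm) ≤ p.rhs7 (1 / p.c) * (p.B * -p.Bm) := mul_le_mul_of_nonneg_right hm7 hBBm.le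
    nlinarith
  · -- B8
    rw [dB, dBm, habsBm,
      show 1 / (p.B / p.z) + 1 / (-p.Bm / p.z) = 2 * p.z * p.s0 / (p.B * -p.Bm) by
        have : -p.Bm ≠ 0 := q3.ne'
        unfold Pt.B Pt.Bm at *; field_simp; ring,
      div_le_iff₀ hBBm, ← r8]
    have k : 2 * p.s0 < p.rhs8 e * (p.B * -p.Bm) := by linarith
    have k2 : p.rhs8 e * (p.B * -p.Bm) ≤ p.rhs8 (1 / p.c) * (p.B * -p.Bm) := mul_le_mul_of_nonneg_right hm8 hBBm.le
    nlinarith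

end Pt

/-! ### The main theorem -/

/-- `e^{−7/10} < 1/2`. [folklore] -/
theorem exp_neg_seven_tenths_lt : Real.exp (-(7 / 10 : ℝ)) < 1 / 2 := by
  have h := Real.sum_le_exp_of_nonneg (show (0 : ℝ) ≤ 7 / 10 by norm_num) 4
  have hs : ∑ i ∈ Finset.range 4, (7 / 10 : ℝ) ^ i / (Nat.factorial i) = 12013 / 6000 := by
    simp [Finset.sum_range_succ, Nat.factorial]
    norm_num
  rw [hs] at h
  rw [Real.exp_neg, inv_lt_comm₀ (Real.exp_pos _) (by norm_num)]
  linarith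

/-- **The eight certified bulk envelopes of the series profile** (clause (g) `CavityTubeBulk` of the cavity tube of the
crux `DenseExcursion`, uniformly in the speed `r ∈ [13890041/12500000, 697/625]` and the sonic scale `c ∈ [17/50, 23/50]`),
for every `x ∈ [log(1/100), −7/10]`. [cite: BuckmasterCaolaboraGomezserrano2025, Prop. 2.5, App. B] -/
theorem bulk_envelopes_window2 {r c : ℝ} (hr : r ∈ Set.Icc ((13890041/12500000 : ℚ) : ℝ) ((697/625 : ℚ) : ℝ))
    (hc : c ∈ Set.Icc (17 / 50 : ℝ) (23 / 50)) : ∀ x : ℝ, Real.log (1 / 100) ≤ x → x ≤ -(7 / 10) →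
    |(deriv (Wser r c) x / 3 - deriv (Sser r c) x - 2 * Sser r c x) * (Wser r c x - 1 + Sser r c x) / (2 * Sser r c x)| ≤ 1 / 2 * Real.exp (-x) ∧
    |deriv (fun y => (deriv (Wser r c) y / 3 - deriv (Sser r c) y - 2 * Sser r c y) * (Wser r c y - 1 + Sser r c y) / (2 * Sser r c y)) x| ≤ 51 / 100 * Real.exp (-x) ∧
    |(deriv (Wser r c) x / 3 + deriv (Sser r c) x + 2 * Sser r c x) * (Wser r c x - 1 - Sser r c x) / (2 * Sser r c x)| ≤ 51 / 100 * Real.exp (-x) + 61 / 100 ∧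
    |deriv (fun y => (deriv (Wser r c) y / 3 + deriv (Sser r c) y + 2 * Sser r c y) * (Wser r c y - 1 - Sser r c y) / (2 * Sser r c y)) x| ≤ 51 / 100 * Real.exp (-x) ∧
    |deriv (Wser r c) x / 3 - deriv (Sser r c) x - 2 * Sser r c x| * |deriv (Wser r c) x / 3 + deriv (Sser r c) x + 2 * Sser r c x| / (2 * Sser r c x) ≤ 53 / 100 * Real.exp (-x) ∧
    |deriv (fun y => -(2 / 3 * deriv (Wser r c) y + 2 * Wser r c y - r) + (Wser r c y - 1) * (2 * deriv (Sser r c) y + 4 * Sser r c y) / Sser r c y) x| ≤ 1 / 5 ∧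
    (2 / 3 * deriv (Wser r c) x + 2 * Wser r c x - r + 2 * deriv (Sser r c) x + 4 * Sser r c x) / (Wser r c x - 1 + Sser r c x)
      + (2 / 3 * deriv (Wser r c) x + 2 * Wser r c x - r - 2 * deriv (Sser r c) x - 4 * Sser r c x) / |Wser r c x - 1 - Sser r c x|
        ≤ Real.exp x * (3 + 4 * Real.exp (2 * x) + 10 * Real.exp (4 * x)) ∧
    1 / (Wser r c x - 1 + Sser r c x) + 1 / |Wser r c x - 1 - Sser r c x| ≤ Real.exp x * (17 / 5 + 4 * Real.exp (2 * x) + 8 * Real.exp (4 * x)) := by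
  intro x hx1 hx2
  obtain ⟨hc1, hc2⟩ := hc
  have hc0 : 0 < c := by linarith
  have hex0 : 0 < Real.exp x := Real.exp_pos x
  -- the range of `ζ = c eˣ`
  have hlo : c / 100 ≤ c * Real.exp x := by
    have h1 : Real.exp (Real.log (1 / 100)) ≤ Real.exp x := Real.exp_le_exp.mpr hx1
    rw [Real.exp_log (by norm_num)] at h1
    rw [div_eq_mul_one_div]; exact mul_le_mul_of_nonneg_left h1 hc0.le
  have hhi : c * Real.exp x ≤ c / 2 := by
    have h1 : Real.exp x < 1 / 2 := (Real.exp_le_exp.mpr hx2).trans_lt exp_neg_seven_tenths_lt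
    rw [div_eq_mul_one_div]; exact mul_le_mul_of_nonneg_left h1.le hc0.le
  have hz : 0 < c * Real.exp x := by positivity
  have hdisc : (73 / 25 : ℝ) * (c * Real.exp x) < 1 := by nlinarith
  -- the sign conditions and the algebra
  obtain ⟨e, he0, he, hP⟩ := bulk_pos_window2 hr ⟨hc1, hc2⟩ hlo hhi
  have A := Pt.bulk_of_pos (pt r c (c * Real.exp x)) hP hz hc0 he0 he
  have hX : c * Real.exp x / c = Real.exp x := by field_simp
  have hE : c / (c * Real.exp x) = Real.exp (-x) := by rw [Real.exp_neg]; field_simp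
  simp only [pt_z, pt_c, pt_r, pt_W0, pt_W1, pt_W2, Pt.s0, Pt.s1, Pt.s2, pt_U0, pt_U1, pt_U2, hX, hE] at A
  obtain ⟨A1, A2, A3, A4, A5, A6, A7, A8⟩ := A
  -- the values and derivatives of the series profile at `x`
  have hW1 := hasDerivAt_Wser hr hc0 hdisc
  have hW2 := hasDerivAt_deriv_Wser hr hc0 hdisc
  have hS1 := hasDerivAt_Sser hr hc0 hdisc
  have hS2 := hasDerivAt_deriv_Sser hr hc0 hdisc
  have hS0 : Sser r c x ≠ 0 := by
    rw [Sser_eq_fU hc0]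
    have : 0 < fU r 0 (c * Real.exp x) := hP.1
    positivity
  have e2 : Real.exp (2 * x) = Real.exp x ^ 2 := by rw [← Real.exp_nat_mul]; norm_num
  have e4 : Real.exp (4 * x) = Real.exp x ^ 4 := by rw [← Real.exp_nat_mul]; norm_num
  rw [deriv_G_eq hW1 hW2 hS1 hS2 hS0, deriv_H_eq hW1 hW2 hS1 hS2 hS0, deriv_R_eq r hW1 hW2 hS1 hS2 hS0,
    hW1.deriv, hS1.deriv, Wser_eq_fW, Sser_eq_fU hc0, e2, e4]
  exact ⟨A1, A2, A3, A4, A5, A6, A7, A8⟩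

end CentreW2

end OriginSeries

end BuckmasterCaolaboraGomezserrano2025

end Literature.Analysis.FluidPDE
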